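import Literature.AlgebraicGeometry.Motives.GeneralisedDecompositionOfTheDiagonalProofs
import Literature.Barriers.HodgeConjecture.GeneralisedDecompositionOfTheDiagonal
import HarnessLib

/-!
# Discharge of the named fact `ParanjapeLaterveer_generalisedDecompositionOfTheDiagonal`

Topic `Literature/Barriers/HodgeConjecture`; proofs-only file (no definitions, no new named
facts). The named fact
`Literature.Barriers.HodgeConjecture.ParanjapeLaterveer_generalisedDecompositionOfTheDiagonal`
(`GeneralisedDecompositionOfTheDiagonal.lean:210`)
is closed by ONE TERM from results already in the tree: the accepted reduction

`Literature.Barriers.HodgeConjecture.ParanjapeLaterveer_generalisedDecompositionOfTheDiagonal.of_motives`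
(`GeneralisedDecompositionOfTheDiagonal.lean:539`)
applied to the accepted unconditional discharges
`ParanjapeLaterveer_generalisedDecompositionOfTheDiagonal_holds` of its hypotheses.
Found by the librarian's forward-chaining census (sweep g29, 2026-08-16): the reduction and the
last of its inputs landed in
different units, so nobody had written the closing line.
-/

namespace Literature.Barriers.HodgeConjecture

/-- **`ParanjapeLaterveer_generalisedDecompositionOfTheDiagonal` holds**: the reduction
`of_motives` applied to `ParanjapeLaterveer_generalisedDecompositionOfTheDiagonal_holds`.
[folklore] -/
theorem ParanjapeLaterveer_generalisedDecompositionOfTheDiagonal_holds :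
    _root_.Literature.Barriers.HodgeConjecture.ParanjapeLaterveer_generalisedDecompositionOfTheDiagonal :=
  _root_.Literature.Barriers.HodgeConjecture.ParanjapeLaterveer_generalisedDecompositionOfTheDiagonal.of_motives
    _root_.Literature.AlgebraicGeometry.Motives.ParanjapeLaterveer_generalisedDecompositionOfTheDiagonal_holds

end Literature.Barriers.HodgeConjecture
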